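import Literature.NumberTheory.PAdicHodge.WeilPairingPeriodExtension
import Literature.NumberTheory.PAdicHodge.DeRhamOfPeriodHoms
import HarnessLib

/-!
# The Hodge–Tate reading of the dual exponential: `θ(Pη(η σ)) = θ(ψ σ) · ι_F(b) + (σ m − m)`

Topic `Literature/NumberTheory/PAdicHodge`; THEOREMS ONLY (no definition, no named fact, no instance, no `sorry`). For a cocycle
`η : Γ_F → T_pW` admitting a dual exponential in Kato's sense (`PeriodRingData.HasDualExp` for `B = B_dR(F)`, `ψ = log χ_cyclo`:
`1 ⊗ η(σ) − log χ(σ) · x = σ y − y` with `x ∈ Fil⁰ D_dR(V)`, `y ∈ B_dR⁺ ⊗ V` — the surjectivity half of Prop. 1.2.3, the tree's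
`cupLogInjective_and_hasDualExp_of_isDeRham_holds`) and ANY `Γ_F`-equivariant `ℤ_p`-homogeneous period map `Pη : T_pW → B_dR⁺(F)`:

★★ `exists_thetaBdR_period_eq_of_hasDualExp` — **there are `b ∈ F` and `m ∈ ℂ_F` with `θ(Pη(η σ)) = θ(ψ σ) · ι_F(b) + (σ m − m)`
for all `σ`** (`ψ` any `ℤ_p`-lift of `log χ_cyclo`). Proof: contract the defining relation with the `B_dR`-linear functional
`c_Φ : B_dR ⊗ V → B_dR`, `b ⊗ v ↦ b · Φ(v)` (`Φ` the equivariant extension of `Pη` to `V_pW`, `DeRhamOfPeriodHoms`): `c_Φ(x) ∈ B_dR^{Γ_F} = F`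
(Fontaine's regularity `invariants_eq`), `c_Φ(y) ∈ Fil⁰ = B_dR⁺`, and `θ` is `Γ_F`-equivariant. So `b = c_Φ(exp* η)` is the weight-`0`
Hodge–Tate coordinate of `exp*(η)` against `Pη`.

This is hypothesis (HT) of `RecognitionFromTeichLog.exists_recognition_of_isTeichLog` /
`TatePairingPointOfTeichLogRecognition.tatePairingPoint_eq_neg_trace_of_isTeichLog` (line `kato_lever` of crux K★
`stmt-BirchSwinnertonDyer-22226`): after this file, Kato's explicit reciprocity law at a completion is reduced (B_crys-free) to the
SINGLE membership statement (K₂) «`p^N · x̃(η σ) ∈ X⁰₂`» plus the de Rham input `HasDualExp` the tree already proves on the cells.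
BSD / K★ / [REC] are NOT proved by any of this.

## References
* K. Kato, LNM 1553 (1993), Ch. II §1.2.4–1.2.7 (the dual exponential, Tate's `H¹(K, ℂ_p) = K · log χ`), Prop. 1.2.3. [Kato1993LNM1553]
* J. Tate, *p-divisible groups* (1967), §3.3 Thm. 2. [Tate1967]
* J.-M. Fontaine, Astérisque 223 (1994), Exp. III §1.5 (regularity `B_dR^{G_K} = K`). [FontaineAsterisque223III]
-/

noncomputable section

open Field Function ValuativeRel WittVector
open scoped TensorProduct

namespace Literature.NumberTheory.PAdicHodge

open Literature.NumberTheory.GaloisRepresentations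
open Literature.NumberTheory.GaloisRepresentations.IsNonarchimedeanLocalField
open Literature.NumberTheory.GaloisCohomology
open Literature.NumberTheory.EllipticCurves
open _root_.WeierstrassCurve

namespace BdRPlusTop

variable {F : Type} [Field F] [ValuativeRel F] [TopologicalSpace F] [IsNonarchimedeanLocalField F] [CharZero F]
  {p : ℕ} [Fact p.Prime] [Fact (¬ IsUnit (p : integerC F))] [IsAdicComplete (Ideal.span {(p : integerC F)}) (integerC F)]
  (hp : valuation F p < 1) [Algebra ℚ_[p] F] (halg : ∀ c : ℚ_[p], algebraMap ℚ_[p] F c = LocalField.padicRingHom F p hp c)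
  {K₀ : Type} [Field K₀] [Algebra K₀ F] (W : WeierstrassCurve K₀) [W.IsElliptic]

include halg in
/-- ★★ **The Hodge–Tate reading of the dual exponential.** Let `Pη : T_pW → B_dR⁺(F)` be additive, `ℤ_p`-homogeneous and
`Γ_F`-equivariant, `ψ` a `ℤ_p`-valued lift of `log χ_cyclo`, and let the cocycle `η` admit a dual exponential (`HasDualExp`, Kato II
Prop. 1.2.3 / §1.2.4). Then **`θ(Pη(η σ)) = θ(ψ σ) · ι_F(b) + (σ m − m)` for some `b ∈ F`, `m ∈ ℂ_F` and all `σ ∈ Γ_F`** — the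
weight-`0` Hodge–Tate coordinate of `η` against `Pη` is `exp*`-proportional to `log χ` up to a coboundary (Tate).
[cite: Kato1993LNM1553, Ch. II §1.2.4–1.2.7 and Prop. 1.2.3] [cite: Tate1967, §3.3 Theorem 2] [cite: FontaineAsterisque223III, Exp. III §1.5] -/
theorem exists_thetaBdR_period_eq_of_hasDualExp (hF : Function.Surjective (fontaineTheta (integerC F) p))
    (Pη : W.tateModule p →+ BdRPlusTop F p)
    (hPηZ : ∀ (c : ℤ_[p]) (a : W.tateModule p), Pη (c • a) = of F p (qpToBdR (c : ℚ_[p])) * Pη a)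
    (hPη : ∀ (σ : absoluteGaloisGroup F) (a : W.tateModule p), gal F p σ (Pη a) = Pη (restrictedTateRep W F p σ a))
    (ψ : absoluteGaloisGroup F → ℤ_[p]) (hψlog : ∀ τ, (ψ τ : ℚ_[p]) = logCyclotomic (F := F) p τ)
    (η : contOneCocycles (restrictedTateRep W F p).toTopRep)
    (hde : (bdRPeriodRingData (F := F) (p := p) hp).HasDualExp (logCyclotomic p) (restrictedRationalTateRep W F p)
      fun σ => TateModule.toRational p (η.1 σ)) :
    ∃ (b : F) (m : CompletedAlgClosure F), ∀ σ : absoluteGaloisGroup F,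
      thetaBdR ((of F p).symm (Pη (η.1 σ))) =
        thetaBdR (qpToBdR (ψ σ : ℚ_[p]) : BDeRhamPlus (integerC F) p) * algebraMap F (CompletedAlgClosure F) b + (σ • m - m) := by
  haveI : IsDomain (BDeRhamPlus (integerC F) p) := isDomain_bDeRhamPlus hF
  set 𝔅 := bdRPeriodRingData (F := F) (p := p) hp with h𝔅
  -- the period map read in `B_dR`, and its equivariant extension `Φ` to `V_pW`
  set φ : W.tateModule p →+ 𝔅.B :=
    (bdRPlusToFrac hp).toAddMonoidHom.comp (((of F p).symm : BdRPlusTop F p ≃+* BDeRhamPlus (integerC F) p).toAddMonoidHom.comp Pη)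
    with hφdef
  have hφapp : ∀ a, φ a = bdRPlusToFrac hp ((of F p).symm (Pη a)) := fun a => rfl
  have hφZ : ∀ (c : ℤ_[p]) (a : W.tateModule p), φ (c • a) = (c : ℚ_[p]) • φ a := fun c a => by
    rw [hφapp, hφapp, hPηZ, map_mul, RingEquiv.symm_apply_apply, map_mul, bdRPlusToFrac_qpToBdR hp halg, Algebra.smul_def]
  have hφσ : ∀ (σ : absoluteGaloisGroup F) (a : W.tateModule p), φ (absGaloisRestrict K₀ F σ • a) = σ • φ a := fun σ a => by
    rw [hφapp, hφapp, ← restrictedTateRep_apply_apply, ← hPη, ← bdRPlusToFrac_galBdRPlus]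
    rfl
  obtain ⟨Φ, hΦ, hΦσ⟩ := exists_equivariant_extend_rationalTateModule 𝔅 (restrictedRationalTateRep W F p)
    (fun σ a => absGaloisRestrict K₀ F σ • a) (fun _ _ _ => rfl) φ hφZ hφσ
  have hΦfil : ∀ v, Φ v ∈ 𝔅.fil 0 :=
    apply_mem_of_forall_toRational_mem 𝔅 Φ (𝔅.fil 0) fun a => by
      rw [hΦ, hφapp]; exact algebraMap_mem_fil_zero hp (surjective_fontaineTheta_integerC hp) _
  -- the contraction `c_Φ : B ⊗ V → B`, `b ⊗ v ↦ b · Φ v`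
  set cΦ : 𝔅.B ⊗[ℚ_[p]] W.rationalTateModule p →ₗ[ℚ_[p]] 𝔅.B :=
    TensorProduct.lift ((LinearMap.mul ℚ_[p] 𝔅.B).compl₂ Φ) with hcΦ
  have hct : ∀ (b : 𝔅.B) (v : W.rationalTateModule p), cΦ (b ⊗ₜ[ℚ_[p]] v) = b * Φ v := fun b v => by
    rw [hcΦ, TensorProduct.lift.tmul]; rfl
  have hcσ : ∀ (σ : absoluteGaloisGroup F) (z : 𝔅.B ⊗[ℚ_[p]] W.rationalTateModule p),
      cΦ (𝔅.tensorRep (restrictedRationalTateRep W F p) σ z) = σ • cΦ z := fun σ z => by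
    induction z using TensorProduct.induction_on with
    | zero => rw [map_zero, map_zero, smul_zero]
    | tmul b v => rw [PeriodRingData.tensorRep_apply_tmul, hct, hct, hΦσ, smul_mul']
    | add x y hx hy => rw [map_add, map_add, hx, hy, map_add, smul_add]
  have hcF : ∀ (c : F) (z : 𝔅.B ⊗[ℚ_[p]] W.rationalTateModule p), cΦ (c • z) = c • cΦ z := fun c z => by
    induction z using TensorProduct.induction_on with
    | zero => rw [smul_zero, map_zero, smul_zero]
    | tmul b v => rw [TensorProduct.smul_tmul', hct, hct, smul_mul_assoc]
    | add x y hx hy => rw [smul_add, map_add, map_add, hx, hy, smul_add]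
  have hcfil : ∀ z ∈ 𝔅.filTensor (W.rationalTateModule p) 0, cΦ z ∈ 𝔅.fil 0 := fun z hz => by
    obtain ⟨z', rfl⟩ := hz
    induction z' using TensorProduct.induction_on with
    | zero => rw [map_zero, map_zero]; exact Submodule.zero_mem _
    | tmul b v =>
      rw [TensorProduct.AlgebraTensorModule.map_tmul, Submodule.subtype_apply, LinearMap.id_apply, hct]
      have h := 𝔅.mul_mem_fil 0 0 (b : 𝔅.B) _ b.2 (hΦfil v)
      rwa [zero_add] at h
    | add x y hx hy => rw [map_add, map_add]; exact Submodule.add_mem _ hx hy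
  -- the dual exponential and its contraction
  obtain ⟨x, hxD, -, y, hy, hrel⟩ := hde
  -- `c_Φ(x) ∈ B_dR^{Γ} = F`
  have hxinv : ∀ σ : absoluteGaloisGroup F, σ • cΦ x = cΦ x := fun σ => by
    rw [← hcσ, (PeriodRingData.mem_D_iff 𝔅 (restrictedRationalTateRep W F p) x).1 hxD σ]
  obtain ⟨b, hb⟩ : cΦ x ∈ Set.range (algebraMap F 𝔅.B) := by
    rw [← 𝔅.invariants_eq]; exact hxinv
  -- `c_Φ(y) ∈ Fil⁰ = B_dR⁺`
  obtain ⟨yt, hyt⟩ : ∃ yt : BDeRhamPlus (integerC F) p, cΦ y = bdRPlusToFrac hp yt := by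
    obtain ⟨w, hw⟩ := (mem_fil_iff hp (surjective_fontaineTheta_integerC hp)).1 (hcfil y hy)
    exact ⟨w, by rw [hw, zpow_zero, one_mul]; rfl⟩
  have hιF : ∀ c : F, algebraMap F 𝔅.B c = bdRPlusToFrac hp (embBdRHom hp hF c) := fun c => rfl
  have hb' : cΦ x = bdRPlusToFrac hp (embBdRHom hp hF b) := by rw [← hb, hιF]
  refine ⟨b, thetaBdR yt, fun σ => ?_⟩
  -- contract the defining relation of `exp*`
  have h := congrArg cΦ (hrel σ)
  rw [map_sub, map_sub, hcσ, hcF, hct, one_mul, hΦ, hφapp, hb', hyt, ← bdRPlusToFrac_galBdRPlus, Algebra.smul_def, hιF, ← map_mul,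
    ← map_mul, ← map_sub, ← map_sub] at h
  have h' := congrArg thetaBdR (bdRPlusToFrac_injective hp h)
  simp only [map_sub, map_mul, thetaBdR_galBdRPlus, thetaBdR_embBdRHom] at h'
  have hq : thetaBdR (qpToBdR (ψ σ : ℚ_[p]) : BDeRhamPlus (integerC F) p) =
      algebraMap F (CompletedAlgClosure F) (algebraMap ℚ_[p] F (logCyclotomic p σ)) := by
    rw [thetaBdR_qpToBdR hp, hψlog, halg]; rfl
  rw [hq]
  linear_combination h'

end BdRPlusTop

end Literature.NumberTheory.PAdicHodge

end
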